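import Literature.Analysis.Complex.SmoothHypersurfaceDivision
import HarnessLib

/-!
# Transversal smooth hypersurfaces: `(t₁, t₂)` is a regular pair on holomorphic sections

Companion of `SmoothHypersurfaceDivision.lean` (E. M. Chirka, *Complex Analytic Sets* (1989),
§2.8). For `t` holomorphic on an open `U` with a reduced zero at `a` (`t a = 0`, `dt(a) ≠ 0`):

* `exists_eq_zero_slice_of_fderiv_ne_zero` — **the hypersurface `{t = 0}` passes close to every
  point near `a`**: along a fixed direction `v` one reaches a zero of `t` from `z` by a step of
  size `≤ 2‖t z‖` (the slice `s ↦ t (z + s v)` has derivative close to `1`, so `s ↦ s - t(z + s v)`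
  is a contraction: `exists_eq_zero_of_norm_deriv_sub_one_le`);
* `eq_zero_of_forall_eq_zero_of_transversal` — if `t₁ x = t₂ x = 0` with `dt₁(x) ≠ 0` and `dt₂(x)`
  not a multiple of `dt₁(x)` (transversality), then `{t₁ = 0} ∩ {t₂ ≠ 0} ∩ U` accumulates at `x`,
  so a continuous function vanishing there vanishes at `x`;
* `exists_eq_smul_of_mul_eq_mul` — **`t₂ • f = t₁ • g ⟹ t₁ ∣ f`** for holomorphic `f, g` when
  `dt₁ ≠ 0` on `{t₁ = 0}` and the two hypersurfaces are transversal along `{t₁ = t₂ = 0}`: the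
  `k = 2` step of the Koszul bookkeeping for iterated hyperplane sections (injectivity of
  multiplication by `t₂` on `𝒪/t₁𝒪` over the open set), via the division theorem
  `exists_eq_smul_of_eqOn_zero`.

Everything is proved; theorems only.

## References

* E. M. Chirka, *Complex Analytic Sets*, Kluwer (1989), §2.8. [Chirka1989]
-/

noncomputable section

open Metric Set Filter
open scoped Topology

namespace Literature.Analysis.Complex
namespace SCV

variable {E : Type*} [NormedAddCommGroup E] [NormedSpace ℂ E]
  {F : Type*} [NormedAddCommGroup F] [NormedSpace ℂ F]

/-! ### The hypersurface near a reduced zero, and regular pairs -/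

section RegularPair

/-- **The hypersurface passes close to every point near a reduced zero**: if `t a = 0` and
`dt(a) ≠ 0` (`t` holomorphic on the open `U ∋ a`), there are a direction `v` and a neighbourhood
`W` of `a` such that from every `z ∈ W` one reaches a zero of `t` in `U` by a step `s • v` with
`‖s‖ ≤ 2 ‖t z‖` (contraction along the slice, `exists_eq_zero_of_norm_deriv_sub_one_le`).
[cite: Chirka1989, §2.8] -/
theorem exists_eq_zero_slice_of_fderiv_ne_zero {t : E → ℂ} {U : Set E} (hU : IsOpen U)
    (ht : DifferentiableOn ℂ t U) {a : E} (ha : a ∈ U) (hta : t a = 0) (hda : fderiv ℂ t a ≠ 0) :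
    ∃ (v : E), ∃ W ∈ 𝓝 a, ∀ z ∈ W, ∃ s : ℂ, ‖s‖ ≤ 2 * ‖t z‖ ∧ z + s • v ∈ U ∧ t (z + s • v) = 0 := by
  obtain ⟨v, r, hr, W, hW, hWx⟩ := exists_slice_data (f := fun _ : E ↦ (0 : ℂ)) hU ht
    (differentiableOn_const 0) ha hta hda rfl
  refine ⟨v, W, hW, fun z hz ↦ ?_⟩
  obtain ⟨hsl, htz⟩ := hWx z hz
  have hsub : closedBall (0 : ℂ) r ⊆ ball (0 : ℂ) (2 * r) := closedBall_subset_ball (by linarith)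
  have hΦd : ∀ s ∈ closedBall (0 : ℂ) r, DifferentiableAt ℂ (fun u : ℂ ↦ t (z + u • v)) s :=
    fun s hs ↦ (hasDerivAt_slice (ht.differentiableAt (hU.mem_nhds (hsl s (hsub hs)).1))).differentiableAt
  have hΦ' : ∀ s ∈ closedBall (0 : ℂ) r, ‖deriv (fun u : ℂ ↦ t (z + u • v)) s - 1‖ ≤ 1 / 2 :=
    fun s hs ↦ (hsl s (hsub hs)).2.2
  have h0 : ‖(fun u : ℂ ↦ t (z + u • v)) 0‖ ≤ r / 2 := by
    simp only [zero_smul, add_zero]; linarith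
  obtain ⟨s₀, hs₀, hts₀⟩ := exists_eq_zero_of_norm_deriv_sub_one_le hr.le hΦd hΦ' h0
  refine ⟨s₀, ?_, (hsl s₀ (hsub hs₀)).1, hts₀⟩
  have := norm_le_two_mul_norm_apply_zero_of_eq_zero (convex_closedBall _ _) hΦd hΦ'
    (mem_closedBall_self hr.le) hs₀ hts₀
  simpa only [zero_smul, add_zero] using this

/-- Linear algebra: if `L₁ ≠ 0` and `L₂` is not a multiple of `L₁`, some vector is killed by
`L₁` but not by `L₂`. [folklore] -/
theorem exists_apply_eq_zero_apply_ne_zero {L₁ L₂ : E →L[ℂ] ℂ} (h₁ : L₁ ≠ 0)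
    (h : ∀ c : ℂ, L₂ ≠ c • L₁) : ∃ u : E, L₁ u = 0 ∧ L₂ u ≠ 0 := by
  by_contra hcon
  push Not at hcon
  obtain ⟨w, hw⟩ : ∃ w, L₁ w ≠ 0 := by
    by_contra h'
    push Not at h'
    exact h₁ (ContinuousLinearMap.ext h')
  refine h ((L₁ w)⁻¹ * L₂ w) (ContinuousLinearMap.ext fun z ↦ ?_)
  have hz : L₁ (z - ((L₁ w)⁻¹ * L₁ z) • w) = 0 := by
    rw [map_sub, map_smul, smul_eq_mul, mul_right_comm, inv_mul_cancel₀ hw, one_mul, sub_self]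
  have := hcon _ hz
  rw [map_sub, map_smul, smul_eq_mul, sub_eq_zero] at this
  change L₂ z = ((L₁ w)⁻¹ * L₂ w) * L₁ z
  rw [this]
  ring

variable [CompleteSpace F]

omit [NormedSpace ℂ F] [CompleteSpace F] in
/-- **A function vanishing on `{t₁ = 0, t₂ ≠ 0}` vanishes at the transversal points of
`{t₁ = t₂ = 0}`**: if `t₁ x = t₂ x = 0`, `dt₁(x) ≠ 0` and `dt₂(x)` is not a multiple of `dt₁(x)`,
then `{t₁ = 0} ∩ {t₂ ≠ 0} ∩ U` accumulates at `x`, so a function continuous on `U` and zero there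
vanishes at `x`. (Move from `x` by `ε u` with `dt₁(x) u = 0`, `dt₂(x) u = 1`, then correct back
to `{t₁ = 0}` by a step of size `o(ε)` along `v`; `t₂` stays of size `≥ ε/2 - o(ε)`.)
[cite: Chirka1989, §2.8] -/
theorem eq_zero_of_forall_eq_zero_of_transversal {t₁ t₂ : E → ℂ} {f : E → F} {U : Set E}
    (hU : IsOpen U) (ht₁ : DifferentiableOn ℂ t₁ U) (ht₂ : DifferentiableOn ℂ t₂ U)
    (hf : ContinuousOn f U) {x : E} (hx : x ∈ U) (h₁ : t₁ x = 0) (h₂ : t₂ x = 0)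
    (hd₁ : fderiv ℂ t₁ x ≠ 0) (hind : ∀ c : ℂ, fderiv ℂ t₂ x ≠ c • fderiv ℂ t₁ x)
    (hf0 : ∀ y ∈ U, t₁ y = 0 → t₂ y ≠ 0 → f y = 0) : f x = 0 := by
  -- the transversal direction `u`, normalised to `dt₂(x) u = 1`
  obtain ⟨u₀, hu₀₁, hu₀₂⟩ := exists_apply_eq_zero_apply_ne_zero hd₁ hind
  set u : E := (fderiv ℂ t₂ x u₀)⁻¹ • u₀ with hu
  have hu₁ : fderiv ℂ t₁ x u = 0 := by rw [hu, map_smul, hu₀₁, smul_zero]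
  have hu₂ : fderiv ℂ t₂ x u = 1 := by rw [hu, map_smul, smul_eq_mul, inv_mul_cancel₀ hu₀₂]
  -- the correcting direction `v` and neighbourhood `W` for `t₁`
  obtain ⟨v, W, hW, hWz⟩ := exists_eq_zero_slice_of_fderiv_ne_zero hU ht₁ hx h₁ hd₁
  -- a Lipschitz constant for `t₂` near `x`
  obtain ⟨ρ, hρ, K, hK0, hρU, -, hK⟩ := exists_ball_lipschitzOnWith ht₂ hU hx
  -- it suffices to find, in every neighbourhood, a point of `{t₁ = 0, t₂ ≠ 0} ∩ U`
  suffices key : ∀ δ > 0, ∃ y ∈ U, dist y x < δ ∧ t₁ y = 0 ∧ t₂ y ≠ 0 by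
    rw [← norm_le_zero_iff]
    refine le_of_forall_pos_le_add fun η hη ↦ ?_
    rw [zero_add]
    obtain ⟨δ, hδ, hδf⟩ := Metric.continuousWithinAt_iff.1 (hf x hx) η hη
    obtain ⟨y, hyU, hyx, hy₁, hy₂⟩ := key δ hδ
    have h1 : dist (f y) (f x) < η := hδf hyU hyx
    rw [hf0 y hyU hy₁ hy₂, dist_zero_left] at h1
    exact h1.le
  intro δ hδ
  -- smallness: `η` with `4 K ‖v‖ η ≤ 1/2`, then `ε` real, small
  have hKv : 0 ≤ K * ‖v‖ := mul_nonneg hK0 (norm_nonneg v)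
  set η : ℝ := 1 / (8 * (K * ‖v‖ + 1)) with hη
  have hηpos : 0 < η := by rw [hη]; positivity
  have hηK : 4 * K * ‖v‖ * η ≤ 1 / 2 := by
    rw [hη, show 4 * K * ‖v‖ * (1 / (8 * (K * ‖v‖ + 1))) = (K * ‖v‖) / (2 * (K * ‖v‖ + 1)) by
      field_simp; ring]
    rw [div_le_div_iff₀ (by positivity) (by positivity)]
    nlinarith
  -- little-o control of `t₁` and `t₂` along `u` at `x`
  have hsl₁ : HasDerivAt (fun s : ℂ ↦ t₁ (x + s • u)) 0 0 := by
    have := hasDerivAt_slice_zero (ht₁.differentiableAt (hU.mem_nhds hx)) u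
    rwa [hu₁] at this
  have hsl₂ : HasDerivAt (fun s : ℂ ↦ t₂ (x + s • u)) 1 0 := by
    have := hasDerivAt_slice_zero (ht₂.differentiableAt (hU.mem_nhds hx)) u
    rwa [hu₂] at this
  rw [hasDerivAt_iff_isLittleO] at hsl₁ hsl₂
  have ho₁ := hsl₁.def hηpos
  have ho₂ := hsl₂.def (by norm_num : (0 : ℝ) < 1 / 2)
  simp only [zero_smul, add_zero, h₁, h₂, sub_zero, smul_eq_mul, mul_one, mul_zero] at ho₁ ho₂
  -- the neighbourhood conditions, all eventually in `s → 0`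
  have hWev : ∀ᶠ s : ℂ in 𝓝 0, x + s • u ∈ W := by
    have hc : Continuous fun s : ℂ ↦ x + s • u := by fun_prop
    have : Tendsto (fun s : ℂ ↦ x + s • u) (𝓝 0) (𝓝 x) := by
      simpa using hc.tendsto 0
    exact this.eventually_mem hW
  have hsmall : ∀ᶠ s : ℂ in 𝓝 0, ‖s‖ * (‖u‖ + 2 * η * ‖v‖ + 1) < min δ ρ := by
    have hc : Continuous fun s : ℂ ↦ ‖s‖ * (‖u‖ + 2 * η * ‖v‖ + 1) := by fun_prop
    have : Tendsto (fun s : ℂ ↦ ‖s‖ * (‖u‖ + 2 * η * ‖v‖ + 1)) (𝓝 0) (𝓝 0) := by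
      simpa using hc.tendsto 0
    exact this.eventually (gt_mem_nhds (lt_min hδ hρ))
  obtain ⟨ε₀, hε₀, hall⟩ := Metric.eventually_nhds_iff_ball.1 (ho₁.and (ho₂.and (hWev.and hsmall)))
  -- a real non-zero parameter `ε`
  set ε : ℂ := ((ε₀ / 2 : ℝ) : ℂ) with hε
  have hεn : ‖ε‖ = ε₀ / 2 := by
    rw [hε, Complex.norm_real, Real.norm_eq_abs, abs_of_pos (half_pos hε₀)]
  have hεpos : 0 < ‖ε‖ := by rw [hεn]; exact half_pos hε₀
  have hεmem : ε ∈ ball (0 : ℂ) ε₀ := by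
    rw [mem_ball, dist_zero_right, hεn]; linarith
  obtain ⟨hb₁, hb₂, hzW, hzs⟩ := hall ε hεmem
  -- the point `z = x + ε u` and its correction `y = z + s v ∈ {t₁ = 0}`
  set z : E := x + ε • u with hz
  obtain ⟨s, hs, hyU, hy₁⟩ := hWz z hzW
  have hsε : ‖s‖ ≤ 2 * η * ‖ε‖ := by linarith
  have hzx : ‖z - x‖ = ‖ε‖ * ‖u‖ := by rw [hz, add_sub_cancel_left, norm_smul]
  have hyx : dist (z + s • v) x ≤ ‖ε‖ * (‖u‖ + 2 * η * ‖v‖) := by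
    rw [dist_eq_norm]
    calc ‖z + s • v - x‖ = ‖(z - x) + s • v‖ := by abel_nf
      _ ≤ ‖z - x‖ + ‖s • v‖ := norm_add_le _ _
      _ ≤ ‖ε‖ * ‖u‖ + 2 * η * ‖ε‖ * ‖v‖ := by
          rw [hzx]
          have : ‖s • v‖ ≤ 2 * η * ‖ε‖ * ‖v‖ := by
            rw [norm_smul]; exact mul_le_mul_of_nonneg_right hsε (norm_nonneg v)
          linarith
      _ = ‖ε‖ * (‖u‖ + 2 * η * ‖v‖) := by ring
  have hεtot : ‖ε‖ * (‖u‖ + 2 * η * ‖v‖) < min δ ρ := by nlinarith [norm_nonneg ε]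
  refine ⟨z + s • v, hyU, lt_of_le_of_lt hyx (lt_of_lt_of_le hεtot (min_le_left _ _)), hy₁, ?_⟩
  -- `t₂ (z + s v) ≠ 0`: `‖t₂ z‖ ≥ ‖ε‖/2` and the correction costs at most `K ‖s v‖ ≤ 2 K η ‖v‖ ‖ε‖`
  have hzρ : z ∈ ball x ρ := by
    rw [mem_ball, dist_eq_norm, hzx]
    have : ‖ε‖ * ‖u‖ ≤ ‖ε‖ * (‖u‖ + 2 * η * ‖v‖) := by
      apply mul_le_mul_of_nonneg_left _ (norm_nonneg ε); nlinarith [norm_nonneg v]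
    exact lt_of_le_of_lt this (lt_of_lt_of_le hεtot (min_le_right _ _))
  have hyρ : z + s • v ∈ ball x ρ := lt_of_le_of_lt hyx (lt_of_lt_of_le hεtot (min_le_right _ _))
  have ht₂z : ‖ε‖ / 2 ≤ ‖t₂ z‖ := by
    have h3 : ‖ε‖ - ‖t₂ z‖ ≤ ‖t₂ z - ε‖ := by
      rw [← norm_neg (t₂ z - ε), neg_sub]; exact norm_sub_norm_le _ _
    rw [hz] at h3 ⊢
    linarith
  have hlip : ‖t₂ (z + s • v) - t₂ z‖ ≤ K * ‖s • v‖ := by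
    have := hK _ hyρ _ hzρ
    rwa [add_sub_cancel_left] at this
  intro h0
  rw [h0, zero_sub, norm_neg] at hlip
  have h4 : K * ‖s • v‖ ≤ 2 * K * η * ‖v‖ * ‖ε‖ := by
    rw [norm_smul]
    calc K * (‖s‖ * ‖v‖) ≤ K * (2 * η * ‖ε‖ * ‖v‖) := by gcongr
      _ = 2 * K * η * ‖v‖ * ‖ε‖ := by ring
  nlinarith [norm_nonneg v]

/-- **`(t₁, t₂)` is a regular pair on sections when the hypersurfaces meet transversally**
(the `k = 2` Koszul step of iterated hyperplane sections): let `t₁, t₂` be holomorphic on an open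
`U` with `dt₁ ≠ 0` on `{t₁ = 0}` and `dt₁, dt₂` linearly independent on `{t₁ = t₂ = 0}`, and let
`f, g` be holomorphic on `U` (values in a complete space) with `t₂ • f = t₁ • g` on `U`. Then
`f = t₁ • h` on `U` for some holomorphic `h`. [cite: Chirka1989, §2.8] -/
theorem exists_eq_smul_of_mul_eq_mul {t₁ t₂ : E → ℂ} {f g : E → F} {U : Set E} (hU : IsOpen U)
    (ht₁ : DifferentiableOn ℂ t₁ U) (ht₂ : DifferentiableOn ℂ t₂ U) (hf : DifferentiableOn ℂ f U)
    (hd₁ : ∀ x ∈ U, t₁ x = 0 → fderiv ℂ t₁ x ≠ 0)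
    (hind : ∀ x ∈ U, t₁ x = 0 → t₂ x = 0 → ∀ c : ℂ, fderiv ℂ t₂ x ≠ c • fderiv ℂ t₁ x)
    (h : ∀ x ∈ U, t₂ x • f x = t₁ x • g x) :
    ∃ h : E → F, DifferentiableOn ℂ h U ∧ ∀ x ∈ U, f x = t₁ x • h x := by
  refine exists_eq_smul_of_eqOn_zero hU ht₁ hf hd₁ fun x hx hx₁ ↦ ?_
  have hoff : ∀ y ∈ U, t₁ y = 0 → t₂ y ≠ 0 → f y = 0 := fun y hy hy₁ hy₂ ↦ by
    have := h y hy
    rw [hy₁, zero_smul] at this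
    exact (smul_eq_zero.1 this).resolve_left hy₂
  by_cases hx₂ : t₂ x = 0
  · exact eq_zero_of_forall_eq_zero_of_transversal hU ht₁ ht₂ hf.continuousOn hx hx₁ hx₂
      (hd₁ x hx hx₁) (hind x hx hx₁ hx₂) hoff
  · exact hoff x hx hx₁ hx₂

end RegularPair

end SCV
end Literature.Analysis.Complex
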